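import Summits.Ventures.PercRepro.C041MultiExitCount

/-!
# ROW C-041 — THEOREM (BLOCK MAP, `r` EXITS): the six-vector of a multi-exit attachment is the sum over the
colourings of the multigraph of the product over the merged exits of the per-exit vectors times, over the blocks of
separated exits, `θ_R` of the product of the block's per-exit vectors (p6, gen 33; mine-3's C-041.md §20 (c)
BLOCK MAPS, the general form of `sixVec_glue2` … `sixVec_glue5`)

Setting of `C041MultiExitCount`: `hang Z₁ u Z a` (the unmarked multigraph `Z₁` with the zone `Z k` hung at the
exit `u k` for every `k : ι`), anchor `inl a₁`; the one-zone classes `cls`, the EXIT VECTOR `exitVec Z a r`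
(`Π(Z)` if the exit is reached, `θ_B Π(Z)` if not; `C041TwoExitSix`) and `exitOf w r` for a six-vector `w`.  THE
BLOCK MAP of the host (`blockMap Z₁ u a₁ w`, for six-vectors `w k` of the zones) is

  `Σ_ω (∏_{k merged under ω} exitOf (w k) rd_k) · ∏_{B block under ω} θ_R (∏_{k ∈ B} exitOf (w k) rd_k)`

— a multilinear function of the `w k` indexed by the colourings of `Z₁` (`merged`, `blocks`, `Rd` of
`C041MultiExitCount`; the empty product is `𝟙`).  THEOREM (BLOCK MAP, `r` EXITS) (`sixVec_hang`,
`sixVec_hang_eq_blockMap`): `Π(hang Z₁ u Z a)` at the anchor is the block map of the host evaluated at the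
six-vectors of the zones — for EVERY finite family of zones, every unmarked host, every anchor.  Proof: the
six-vector is the sum over `ω` of the fibre vectors (`sixVec_eq_sum_fibVec`, the six classes as conditions on the
pair), and the fibre vector of `ω` is the stated product coordinate by coordinate (`fibVec_eq`: `card_fib` of
`C041MultiExitCount`, with `θ_R (∏_B x_k) = (Σ, Σ, Σ, Σ', Σ', Σ')` of the inclusion–exclusion sums).  The
instances `r = 2, 3, 4, 5` on the `Sum`-typed attachments are `C041TwoExitMain` … `C041FiveExitMain`.
-/

namespace PercRepro

namespace ZoneZ

namespace MultiExit

open ZoneData Pendant Finset TwoExit TreeClosure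

variable {ι V₁ E₁ U₁ U₂ : Type} {V E T₁ T₂ : ι → Type}
variable (Z₁ : ZoneData V₁ E₁ U₁ U₂) (u : ι → V₁) (Z : (k : ι) → ZoneData (V k) (E k) (T₁ k) (T₂ k))
  (a : (k : ι) → V k) (a₁ : V₁)
variable [Fintype ι] [DecidableEq ι] [∀ k, Fintype (E k)] [∀ k, DecidableEq (E k)] [∀ k, Fintype (T₁ k)]
  [∀ k, DecidableEq (T₁ k)] [∀ k, Fintype (T₂ k)] [∀ k, DecidableEq (T₂ k)] [Fintype E₁] [DecidableEq E₁]

/-! ## The fibre vectors -/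

/-- The six fibre counts over a colouring `ω` of `Z₁`. -/
noncomputable def fibVec (ω : E₁ → Bool) : Vec6 :=
  ![(#(fib Z₁ u Z a a₁ ω true true false) : ℝ), #(fib Z₁ u Z a a₁ ω false true false),
    #(fib Z₁ u Z a a₁ ω true false false), #(fib Z₁ u Z a a₁ ω true true true),
    #(fib Z₁ u Z a a₁ ω false true true), #(fib Z₁ u Z a a₁ ω true false true)]

omit [Fintype E₁] [DecidableEq E₁] in
/-- A fibre is the filter of its condition (with any decidability instance). -/
theorem fib_eq_filter (ω : E₁ → Bool) (c1 c2 k : Bool)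
    [DecidablePred fun τ : (k : ι) → State (E k) (T₁ k) (T₂ k) => fibCond Z₁ u Z a a₁ ω c1 c2 k τ] :
    fib Z₁ u Z a a₁ ω c1 c2 k = univ.filter fun τ => fibCond Z₁ u Z a a₁ ω c1 c2 k τ := by
  ext τ
  rw [mem_fib, Finset.mem_filter]
  exact (and_iff_right (Finset.mem_univ _)).symm

/-- One count of the attachment, as the sum over the colourings of the fibre counts. -/
theorem card_eq_sum_card_fib (S : Finset (State (E₁ ⊕ (Σ k, E k)) (Σ k, T₁ k) (Σ k, T₂ k))) (c1 c2 k : Bool)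
    (h : ∀ σ, σ ∈ S ↔ fibCond Z₁ u Z a a₁ (col₁ σ) c1 c2 k (st σ)) :
    #S = ∑ ω : E₁ → Bool, #(fib Z₁ u Z a a₁ ω c1 c2 k) := by
  classical
  have e : S = univ.filter fun σ => fibCond Z₁ u Z a a₁ (col₁ σ) c1 c2 k (st σ) := by
    ext σ
    rw [h, Finset.mem_filter]
    exact (and_iff_right (Finset.mem_univ _)).symm
  rw [e, card_filter_eq _ (fun p : (E₁ → Bool) × ((k : ι) → State (E k) (T₁ k) (T₂ k)) =>
    fibCond Z₁ u Z a a₁ p.1 c1 c2 k p.2) (fun _ => Iff.rfl), card_filter_prod_eq_sum]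
  refine Finset.sum_congr rfl fun ω _ => ?_
  rw [fib_eq_filter]

/-- **The six-vector of the attachment is the sum of the fibre vectors.** -/
theorem sixVec_eq_sum_fibVec :
    (hang Z₁ u Z a).sixVec (Sum.inl a₁) = ∑ ω : E₁ → Bool, fibVec Z₁ u Z a a₁ ω := by
  refine vec6_ext _ _ ?_ ?_ ?_ ?_ ?_ ?_
  · rw [Finset.sum_apply, sixVec_zero,
      card_eq_sum_card_fib Z₁ u Z a a₁ _ true true false (mem_Fset_iff Z₁ u Z a a₁)]
    push_cast
    simp only [fibVec, Matrix.cons_val]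
  · rw [Finset.sum_apply, sixVec_one,
      card_eq_sum_card_fib Z₁ u Z a a₁ _ false true false (mem_FAset_iff Z₁ u Z a a₁)]
    push_cast
    simp only [fibVec, Matrix.cons_val]
  · rw [Finset.sum_apply, sixVec_two,
      card_eq_sum_card_fib Z₁ u Z a a₁ _ true false false (mem_FBset_iff Z₁ u Z a a₁)]
    push_cast
    simp only [fibVec, Matrix.cons_val]
  · rw [Finset.sum_apply, sixVec_three,
      card_eq_sum_card_fib Z₁ u Z a a₁ _ true true true (mem_IFset_iff Z₁ u Z a a₁)]
    push_cast
    simp only [fibVec, Matrix.cons_val]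
  · rw [Finset.sum_apply, sixVec_four,
      card_eq_sum_card_fib Z₁ u Z a a₁ _ false true true (mem_IAset_iff Z₁ u Z a a₁)]
    push_cast
    simp only [fibVec, Matrix.cons_val]
  · rw [Finset.sum_apply, sixVec_five,
      card_eq_sum_card_fib Z₁ u Z a a₁ _ true false true (mem_IBset_iff Z₁ u Z a a₁)]
    push_cast
    simp only [fibVec, Matrix.cons_val]

/-! ## The fibre vector of one colouring is the product over the status pattern -/

omit [Fintype E₁] [DecidableEq E₁] in
/-- **The fibre vector of a colouring** is the product over the merged exits of the exit vectors times, over the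
blocks, `θ_R` of the product of the block's exit vectors. -/
theorem fibVec_eq (ω : E₁ → Bool) :
    fibVec Z₁ u Z a a₁ ω =
      (∏ k ∈ merged Z₁ u a₁ ω, exitVec (Z k) (a k) (Z₁.Rd a₁ (u k) ω)) *
        ∏ B ∈ blocks Z₁ u a₁ ω, thR (∏ k ∈ B, exitVec (Z k) (a k) (Z₁.Rd a₁ (u k) ω)) := by
  refine vec6_ext _ _ ?_ ?_ ?_ ?_ ?_ ?_
  · simp only [fibVec, Matrix.cons_val, Pi.mul_apply, Finset.prod_apply, thR, nAdm, kInv, exitVec]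
    rw [card_fib Z₁ u Z a a₁ ω true true false (Or.inl rfl)]
  · simp only [fibVec, Matrix.cons_val, Pi.mul_apply, Finset.prod_apply, thR, nAdm, kInv, exitVec]
    rw [card_fib Z₁ u Z a a₁ ω false true false (Or.inr rfl)]
  · simp only [fibVec, Matrix.cons_val, Pi.mul_apply, Finset.prod_apply, thR, nAdm, kInv, exitVec]
    rw [card_fib Z₁ u Z a a₁ ω true false false (Or.inl rfl)]
  · simp only [fibVec, Matrix.cons_val, Pi.mul_apply, Finset.prod_apply, thR, nAdm, kInv, exitVec]
    rw [card_fib Z₁ u Z a a₁ ω true true true (Or.inl rfl)]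
  · simp only [fibVec, Matrix.cons_val, Pi.mul_apply, Finset.prod_apply, thR, nAdm, kInv, exitVec]
    rw [card_fib Z₁ u Z a a₁ ω false true true (Or.inr rfl)]
  · simp only [fibVec, Matrix.cons_val, Pi.mul_apply, Finset.prod_apply, thR, nAdm, kInv, exitVec]
    rw [card_fib Z₁ u Z a a₁ ω true false true (Or.inl rfl)]

/-! ## THEOREM (BLOCK MAP, `r` EXITS) -/

/-- **THEOREM (BLOCK MAP, `r` EXITS)**: the six-vector of the multi-exit attachment at the anchor is the sum over
the colourings `ω` of `Z₁` of the product over the merged exits of `exitOf Π(Z k) rd_k` (`Π(Z k)` if the exit is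
reached, `θ_B Π(Z k)` if not) times, over the blocks of blue-connected separated exits, `θ_R` of the product of the
block's vectors. -/
theorem sixVec_hang :
    (hang Z₁ u Z a).sixVec (Sum.inl a₁) = ∑ ω : E₁ → Bool,
      (∏ k ∈ merged Z₁ u a₁ ω, exitOf ((Z k).sixVec (a k)) (Z₁.Rd a₁ (u k) ω)) *
        ∏ B ∈ blocks Z₁ u a₁ ω, thR (∏ k ∈ B, exitOf ((Z k).sixVec (a k)) (Z₁.Rd a₁ (u k) ω)) := by
  rw [sixVec_eq_sum_fibVec]
  refine Finset.sum_congr rfl fun ω _ => ?_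
  rw [fibVec_eq]
  simp only [exitOf_sixVec]

/-- THE BLOCK MAP of the host `Z₁` at the anchor `a₁` with the exits `u`, as a function of six-vectors `w k` of
the zones: the sum over the colourings of `Z₁` of the product over the merged exits of `exitOf (w k) rd_k` times,
over the blocks, `θ_R` of the product of the block's `exitOf (w k) rd_k`. -/
noncomputable def blockMap (w : ι → Vec6) : Vec6 :=
  ∑ ω : E₁ → Bool, (∏ k ∈ merged Z₁ u a₁ ω, exitOf (w k) (Z₁.Rd a₁ (u k) ω)) *
    ∏ B ∈ blocks Z₁ u a₁ ω, thR (∏ k ∈ B, exitOf (w k) (Z₁.Rd a₁ (u k) ω))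

/-- **THEOREM (BLOCK MAP, `r` EXITS), block-map form**: the six-vector of the attachment is the block map of the
host evaluated at the six-vectors of the zones. -/
theorem sixVec_hang_eq_blockMap :
    (hang Z₁ u Z a).sixVec (Sum.inl a₁) = blockMap Z₁ u a₁ fun k => (Z k).sixVec (a k) :=
  sixVec_hang Z₁ u Z a a₁

end MultiExit

end ZoneZ

end PercRepro
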